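import Summits.QuantumAdvantage.QuantumAdvantage.Theorems.CubicForrelationNearExactIsExactKtGapOrderStep
import Summits.QuantumAdvantage.QuantumAdvantage.Theorems.CubicForrelationNearExactIsExactKtGapOrderClose

/-!
# Crux `CubicForrelation.NearExactIsExact` (stmt-QuantumAdvantage-14043) — the Kasami–Tokura gap `(1.5d, 1.75d)` for EVERY order and
  EVERY length (assembly), with the instances `RM(5,14)`, `RM(6,18)`, `RM(7,22)`

Certificate seat `b2b-cforr-cert` (gen 45).  HONEST FRAMING: a coding-theory BRICK, kernel-checked with the standard axioms, uniform in the
order `r ≥ 2` and the number of bits `m`: **no Boolean function of degree `≤ r` on `m` bits has weight strictly between `1.5·2^{m-r}` and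
`1.75·2^{m-r}`** (`kt_gap_order`; with the second weight `sw_second_weight_all`: the weights of `RM(r,m)` below `1.75·d` are `0, d, 1.5d`,
`rm_weights_below_seven_quarters_order`).  This is the part of Kasami–Tokura's theorem (1970: the weights of `RM(r,m)` in `[d, 2d)` are the
`2d(1 − 2^{−μ})`) between `μ = 2` and `μ = 3`; the tree had it for `r = 3` only (`kt_gap_cubic`, gens 16–19).  The proof is NOT Kasami–Tokura's:
induction on the order (base `r = 2`: plateaued quadratic spectra, `kto_gap_two`) and on `m` (`kto_step`: derivative intersections via the
order-`(r−1)` gap, half weights via the `(m−1)`-bit gap, Parseval + fourth moment), closed by the uniform Diophantine lemma `kto_no_solution`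
(`2L ∣ t²`, `t² < 8L`, an elimination identity and a 2-adic valuation).  NOT summit progress.

Use at the crux (finite slices): `kt_gap_rm5_fourteen` — a word of `RM(5,14)` has no weight in `(768, 896)` — closes the BENT side of the
`n = 14` window down to the record value `57/64` (…BentFourteenFiftySevenSixtyFourths); `kt_gap_rm6_eighteen`, `kt_gap_rm7_twentytwo` are the
`n = 18, 22` twins (duals of cubic bent functions have degree `≤ 6, 7` there).

References: T. Kasami, N. Tokura, On the weight structure of Reed–Muller codes, IEEE Trans. IT 16 (1970) 752–759, Thm 1; MacWilliams–Sloane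
(1977) Ch. 15 §3.  Axioms: `propext, Classical.choice, Quot.sound`.
-/

set_option linter.dupNamespace false -- D-0017: single-problem summit ⇒ `QuantumAdvantage.QuantumAdvantage` by design

noncomputable section

namespace Summit.QuantumAdvantage.QuantumAdvantage.Theorems.CubicForrelation.NearExactIsExact

open Finset
open Literature.Computability.QuantumComplexity

/-! ### Small lengths -/

/-- **Short codes.**  For `m ≤ ρ + 1` no natural `S` has `3·2^m < 2^{ρ+1}·S` and `2^{ρ+2}·S < 7·2^m` (then `X = 2^{ρ+1−m}·S` would satisfy
`3 < X` and `2X < 7`). [folklore] -/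
theorem kto_gap_small {m ρ : ℕ} (hm : m ≤ ρ + 1) (S : ℕ) : ¬ (3 * 2 ^ m < 2 ^ (ρ + 1) * S ∧ 2 ^ (ρ + 2) * S < 7 * 2 ^ m) := by
  rintro ⟨h1, h2⟩
  obtain ⟨e, he⟩ : ∃ e, ρ + 1 = m + e := ⟨ρ + 1 - m, by omega⟩
  have e1 : (2 : ℕ) ^ (ρ + 1) = 2 ^ m * 2 ^ e := by rw [he, pow_add]
  have e2 : (2 : ℕ) ^ (ρ + 2) = 2 ^ m * (2 * 2 ^ e) := by rw [show ρ + 2 = ρ + 1 + 1 by ring, pow_succ, he, pow_add]; ring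
  rw [e1, mul_assoc, mul_comm 3] at h1
  rw [e2, mul_assoc, mul_comm 7] at h2
  have hPm : 0 < (2 : ℕ) ^ m := Nat.two_pow_pos m
  have h1' : 3 < 2 ^ e * S := Nat.lt_of_mul_lt_mul_left h1
  have h2' : 2 * 2 ^ e * S < 7 := Nat.lt_of_mul_lt_mul_left h2
  have : 2 * (2 ^ e * S) < 7 := by rw [← mul_assoc]; exact h2'
  omega

/-! ### The gap, every order and every length -/

/-- **The Kasami–Tokura gap `(1.5d, 1.75d)` of `RM(r,m)`, every `r ≥ 2` and every `m`.**  For every Boolean function `c` of degree `≤ r` on `m`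
bits it is NOT the case that `3·2^m < 2^{r+1}·#{c = 1}` and `2^{r+2}·#{c = 1} < 7·2^m`; i.e. `RM(r,m)` has no weight strictly between
`1.5·2^{m-r}` and `1.75·2^{m-r}`.  NOT summit progress. [this work; cite: KasamiTokura1970 Thm 1] -/
theorem kt_gap_order : ∀ (r : ℕ), 2 ≤ r → ∀ (m : ℕ) (c : (Fin m → Bool) → Bool), IsDegLeFun r c →
    ¬ (3 * 2 ^ m < 2 ^ (r + 1) * #(univ.filter fun x => c x = true) ∧ 2 ^ (r + 2) * #(univ.filter fun x => c x = true) < 7 * 2 ^ m) := by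
  intro r hr
  induction r, hr using Nat.le_induction with
  | base => exact kto_gap_two
  | succ r hr ih =>
    intro m
    induction m with
    | zero => intro c _; exact kto_gap_small (by omega) _
    | succ m ihm =>
      intro c hc h
      rcases Nat.lt_or_ge m (r + 2) with hm | hm
      · exact kto_gap_small (by omega) _ h
      · obtain ⟨k, rfl⟩ : ∃ k, m = k + r + 2 := ⟨m - (r + 2), by omega⟩
        have hP2 : 0 < (2 : ℕ) ^ (r + 2) := Nat.two_pow_pos _
        have hP3 : 0 < (2 : ℕ) ^ (r + 3) := Nat.two_pow_pos _
        have hN3 : 3 * (2 : ℕ) ^ (k + r + 2 + 1) = 2 ^ (r + 1 + 1) * (6 * 2 ^ k) := by ring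
        have hN7 : 7 * (2 : ℕ) ^ (k + r + 2 + 1) = 2 ^ (r + 1 + 2) * (7 * 2 ^ k) := by ring
        obtain ⟨hA, hB⟩ := h
        rw [hN3] at hA
        rw [hN7] at hB
        have h1 : 6 * 2 ^ k < #(univ.filter fun x => c x = true) := Nat.lt_of_mul_lt_mul_left hA
        have h2 : #(univ.filter fun x => c x = true) < 7 * 2 ^ k := Nat.lt_of_mul_lt_mul_left hB
        have ih' : ∀ c' : (Fin (k + r + 2) → Bool) → Bool, IsDegLeFun (r + 1) c' →
            ¬ (3 * 2 ^ k < #(univ.filter fun y => c' y = true) ∧ 2 * #(univ.filter fun y => c' y = true) < 7 * 2 ^ k) := by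
          intro c' hc' h'
          have hK3 : 3 * (2 : ℕ) ^ (k + r + 2) = 2 ^ (r + 1 + 1) * (3 * 2 ^ k) := by ring
          have hK7 : 7 * (2 : ℕ) ^ (k + r + 2) = 2 ^ (r + 1 + 1) * (7 * 2 ^ k) := by ring
          have hK2 : (2 : ℕ) ^ (r + 1 + 2) = 2 ^ (r + 1 + 1) * 2 := by ring
          refine ihm c' hc' ⟨?_, ?_⟩
          · rw [hK3]; exact Nat.mul_lt_mul_of_pos_left h'.1 hP2
          · rw [hK7, hK2, mul_assoc]; exact Nat.mul_lt_mul_of_pos_left h'.2 hP2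
        obtain ⟨w, t, A, B, n₁, n₂, hwS, hwt, hdvd, hAB, hP, hn, hI, h4⟩ :=
          kto_step k r hr ih' (ih (k + r + 2 + 1)) c hc h1 h2
        exact kto_no_solution k r w t A B n₁ n₂ (by omega) hwt (by omega) (by omega) hdvd hAB hP hn hI h4

/-- **The weights of `RM(r,m)` below `1.75 d`, every `r ≥ 2`**: a Boolean function of degree `≤ r` on `m` bits with `2^{r+2}·#{c = 1} < 7·2^m`
has `#{c = 1} = 0`, `2^r·#{c = 1} = 2^m` (`= d`) or `2^{r+1}·#{c = 1} = 3·2^m` (`= 1.5d`) (second weight `sw_second_weight_all` + the gap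
`kt_gap_order`).  NOT summit progress. [this work; cite: KasamiTokura1970 Thm 1] -/
theorem rm_weights_below_seven_quarters_order {r m : ℕ} (hr : 2 ≤ r) (c : (Fin m → Bool) → Bool) (hc : IsDegLeFun r c)
    (h : 2 ^ (r + 2) * #(univ.filter fun x => c x = true) < 7 * 2 ^ m) :
    #(univ.filter fun x => c x = true) = 0 ∨ 2 ^ r * #(univ.filter fun x => c x = true) = 2 ^ m ∨
      2 ^ (r + 1) * #(univ.filter fun x => c x = true) = 3 * 2 ^ m := by
  classical
  by_cases h0 : #(univ.filter fun x => c x = true) = 0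
  · exact Or.inl h0
  have hne : ∃ x, c x = true := by
    by_contra hn
    push Not at hn
    exact h0 (card_eq_zero.2 (filter_eq_empty_iff.2 fun y _ => hn y))
  by_cases hlt : 2 ^ (r + 1) * #(univ.filter fun x => c x = true) < 3 * 2 ^ m
  · exact Or.inr (Or.inl (sw_second_weight_all r hr m c hc hne hlt))
  · right; right
    push Not at hlt
    have hgap := kt_gap_order r hr m c hc
    have hle : ¬ 3 * 2 ^ m < 2 ^ (r + 1) * #(univ.filter fun x => c x = true) := fun h' => hgap ⟨h', h⟩
    exact le_antisymm (not_lt.1 hle) hlt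

/-! ### Instances at the crux's finite slices -/

/-- **`RM(5,14)` has no weight in `(768, 896)`** (`d = 512`): the dual side of a cubic bent function on 14 bits (degree `≤ 5` by Hou) — this
is what closes the bent side of the `n = 14` window down to the record `57/64`.  NOT summit progress. [this work; cite: KasamiTokura1970 Thm 1] -/
theorem kt_gap_rm5_fourteen (c : (Fin (7 + 7) → Bool) → Bool) (hc : IsDegLeFun (4 + 1) c) :
    ¬ (768 < #(univ.filter fun x => c x = true) ∧ #(univ.filter fun x => c x = true) < 896) := by
  have h := kt_gap_order (4 + 1) (by norm_num) (7 + 7) c hc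
  norm_num at h ⊢
  omega

/-- **The weights of `RM(5,14)` below `896`**: `0, 512, 768`.  NOT summit progress. [this work; cite: KasamiTokura1970 Thm 1] -/
theorem rm5_fourteen_weights_below_896 (c : (Fin (7 + 7) → Bool) → Bool) (hc : IsDegLeFun (4 + 1) c)
    (h : #(univ.filter fun x => c x = true) < 896) :
    #(univ.filter fun x => c x = true) = 0 ∨ #(univ.filter fun x => c x = true) = 512 ∨ #(univ.filter fun x => c x = true) = 768 := by
  have hP5 : (2 : ℕ) ^ (4 + 1) = 32 := by norm_num
  have hP6 : (2 : ℕ) ^ (4 + 1 + 1) = 64 := by norm_num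
  have hP7 : (2 : ℕ) ^ (4 + 1 + 2) = 128 := by norm_num
  have hP14 : (2 : ℕ) ^ (7 + 7) = 16384 := by norm_num
  have h' := rm_weights_below_seven_quarters_order (r := 4 + 1) (m := 7 + 7) (by norm_num) c hc (by rw [hP7, hP14]; omega)
  rw [hP5, hP6, hP14] at h'
  omega

/-- **`RM(6,18)` has no weight in `(6144, 7168)`** (`d = 4096`; the dual side of a cubic bent function on 18 bits has degree `≤ 6`).
NOT summit progress. [this work; cite: KasamiTokura1970 Thm 1] -/
theorem kt_gap_rm6_eighteen (c : (Fin (9 + 9) → Bool) → Bool) (hc : IsDegLeFun (4 + 2) c) :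
    ¬ (6144 < #(univ.filter fun x => c x = true) ∧ #(univ.filter fun x => c x = true) < 7168) := by
  have h := kt_gap_order (4 + 2) (by norm_num) (9 + 9) c hc
  norm_num at h ⊢
  omega

/-- **`RM(7,22)` has no weight in `(49152, 57344)`** (`d = 32768`; the dual side of a cubic bent function on 22 bits has degree `≤ 7`).
NOT summit progress. [this work; cite: KasamiTokura1970 Thm 1] -/
theorem kt_gap_rm7_twentytwo (c : (Fin (11 + 11) → Bool) → Bool) (hc : IsDegLeFun (5 + 2) c) :
    ¬ (49152 < #(univ.filter fun x => c x = true) ∧ #(univ.filter fun x => c x = true) < 57344) := by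
  have h := kt_gap_order (5 + 2) (by norm_num) (11 + 11) c hc
  norm_num at h ⊢
  omega

end Summit.QuantumAdvantage.QuantumAdvantage.Theorems.CubicForrelation.NearExactIsExact

end
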